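import Literature.NumberTheory.GaloisRepresentations.QuarticTwistHeckeCharacter
import Literature.NumberTheory.GaloisRepresentations.QuarticSymbolModulus
import Literature.NumberTheory.GaloisRepresentations.BiquadraticReciprocityRationalInteger
import Literature.NumberTheory.NumberFields.CyclotomicFieldFourPrimaryCongruence
import Literature.NumberTheory.QuadraticFields.GaussianPrimary
import Mathlib.NumberTheory.Cyclotomic.Basic
import Mathlib.NumberTheory.Zsqrtd.GaussianInt
import HarnessLib

/-!
# The bridge `ℤ[i] ≃ 𝓞_{ℚ(ζ₄)}` and the quartic symbol `(D/x)₄` of a rational integer on Mathlib's `GaussianInt`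

Topic `Literature/NumberTheory/QuadraticFields`, namespace `Literature.NumberTheory.QuadraticFields.GaussianQuarticSymbol`.
Two definitions and their transport API; no named fact.

The tree formalises Ireland–Rosen's theory of the biquadratic residue symbol (Ch. 9 §§7–9, Ch. 14 §2, Ch. 18 §6)
on the ABSTRACT carrier `𝓞 K`, `IsCyclotomicExtension {4} ℚ K`, with a chosen primitive fourth root of unity
`ζ ∈ 𝓞 K` (`GaloisRepresentations/QuarticResidueSymbol`, `…Composite`, `…BiquadraticReciprocity*`,
`…QuarticSymbolModulus`, `…QuarticTwistHeckeCharacter`), while the analytic theory of `ℚ(i)` — primary Gaussian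
integers and their sums (`QuadraticFields/GaussianPrimary`), weight-one theta series (`LFunctions/GaussianThetaSeries`),
the point count of `y² = x³ − Dx` (`EllipticCurves/CongruentNumberCurveJacobiSums`) — lives on Mathlib's concrete
carrier `GaussianInt = ℤ√-1`.  `NumberFields/CyclotomicFieldFourPrimes` records that «Mathlib has … no ring
isomorphism `𝓞 K ≃+* ℤ√-1`».  This file supplies it and pulls the symbol back:

* §1 `toRingOfIntegers hζ : GaussianInt ≃+* 𝓞 K`, `⟨a, b⟩ ↦ a + bζ` (Mathlib's `Zsqrtd.lift` at `ζ`, injective as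
  `-1` is not a square, surjective by the integral basis `1, ζ` — the tree's `exists_int_add_int_mul_eq_four`), with
  `norm`/`absNorm`, primarity (`GaussianPrimary.IsPrimary x ↔ Φ x ≡ 1 (2 + 2ζ)`, Ireland–Rosen Ch. 9 §7 Lemma 6) and
  coprimality transported;
* §2 `quarticSymbolInt D x : GaussianInt` — Ireland–Rosen's `(D/x)₄ = χ_x(D)` (Ch. 9 §8, Definition after Prop. 9.8.4:
  «`χ_α(β) = ∏ χ_{λᵢ}(β)`», a function of the ideal `(x)`), for a rational integer `D` and `x ∈ ℤ[i]`, read on the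
  model `K = CyclotomicField 4 ℚ`; API: multiplicative in `x` and in `D`, invariant under units, values in
  `{0, ±1, ±i}`, Euler's criterion at a split prime `π` (`π ∣ D^{(p-1)/4} − (D/π)₄`, Prop. 9.8.2), `(D/q)₄ = 1` at an
  inert prime `q ∤ D` (Ch. 18 §6 Lemma), periodicity in `x` modulo `8D` (Ch. 18 §6, proof of Theorem 7), Prop. 9.9.8
  for `a ≡ 1 (4)` and primary `x` (`(a/x)₄ = (x/a)₄`), and the explicit quartic character modulo the inert prime `3`
  (`quarticCharThree`, `(x/3)₄ ≡ x² (mod 3)`).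

## References
* K. Ireland, M. Rosen, *A Classical Introduction to Modern Number Theory* (1982/1990), Ch. 1 §4; Ch. 9 §7 Lemmas 6–8,
  §8 Prop. 9.8.2 and the Definition after Prop. 9.8.4, §9 Prop. 9.9.8; Ch. 18 §6 Lemma and Theorem 7 (proof).
  [IrelandRosen1982]

## Mathlib / tree search
Mathlib: `Zsqrtd.lift`, `Zsqrtd.lift_injective`, `Zsqrtd.norm_def`, `GaussianInt`, `CyclotomicField`,
`IsCyclotomicExtension.zeta_spec`, `IsPrimitiveRoot.toInteger_isPrimitiveRoot`, `Ideal.absNorm_span_singleton`,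
`Ideal.isCoprime_span_singleton_iff`.  Tree: `exists_int_add_int_mul_eq_four`, `norm_int_add_int_mul_four`,
`int_add_int_mul_sub_one_mem_span_iff_four` (`CyclotomicFieldFourPrimaryCongruence`); `quarticSymbol` with
`quarticSymbol_span_mul`, `quarticSymbol_mul_right`, `quarticSymbol_span_of_isUnit`, `quarticSymbol_span_of_span_eq`,
`quarticSymbol_eq_of_sub_mem` (`QuarticResidueSymbolComposite`); `quarticResidueSymbol_spec`,
`quarticResidueSymbol_eq_of_pow_four_eq_one`, `quarticResidueSymbol_eq_zero_or_pow_four`,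
`quarticResidueSymbol_zero_of_two_not_mem` (`QuarticResidueSymbol`);
`quarticSymbol_span_natCast_intCast_eq_one_of_mod_four_eq_three` (`QuarticSymbolModulus`);
`quarticSymbol_span_eq_of_sub_mem_span` (`QuarticTwistHeckeCharacter`); `quarticSymbol_span_intCast_primary_comm`
(`BiquadraticReciprocityRationalInteger`); `GaussianPrimary.IsPrimary`, `eq_of_isUnit` (`GaussianPrimary`).
No `GaussianInt ≃+* 𝓞 _` existed (`lean search '≃\+\* GaussianInt|GaussianInt ≃'`).
-/

noncomputable section

namespace Literature.NumberTheory.QuadraticFields.GaussianQuarticSymbol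

open NumberField IsDedekindDomain Zsqrtd
open Literature.NumberTheory.NumberFields Literature.NumberTheory.GaloisRepresentations
open Literature.NumberTheory.QuadraticFields.GaussianPrimary

/-! ### §1 The ring isomorphism `GaussianInt ≃ 𝓞 K`, `i ↦ ζ` -/

section Bridge

variable {K : Type*} [Field K] [NumberField K] [IsCyclotomicExtension {4} ℚ K] {ζ : 𝓞 K}

omit [NumberField K] [IsCyclotomicExtension {4} ℚ K] in
/-- `ζ · ζ = -1` for a primitive fourth root of unity. [folklore] -/
private theorem mul_self_eq_neg_one (hζ : IsPrimitiveRoot ζ 4) : ζ * ζ = ((-1 : ℤ) : 𝓞 K) := by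
  rw [← sq, (hζ.pow (by norm_num) (show 4 = 2 * 2 by norm_num)).eq_neg_one_of_two_right]
  push_cast; rfl

/-- The ring homomorphism `GaussianInt → 𝓞 K`, `a + bi ↦ a + bζ` (Mathlib's `Zsqrtd.lift` at `ζ`). [folklore] -/
def toRingOfIntegersHom (hζ : IsPrimitiveRoot ζ 4) : GaussianInt →+* 𝓞 K :=
  Zsqrtd.lift ⟨ζ, mul_self_eq_neg_one hζ⟩

omit [NumberField K] [IsCyclotomicExtension {4} ℚ K] in
/-- `Φ(a + bi) = a + bζ`. [folklore] -/
private theorem toRingOfIntegersHom_apply (hζ : IsPrimitiveRoot ζ 4) (x : GaussianInt) :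
    toRingOfIntegersHom hζ x = (x.re : 𝓞 K) + (x.im : 𝓞 K) * ζ := rfl

/-- `Φ` is bijective: injective since `-1` is not a square in `ℤ` (`Zsqrtd.lift_injective`), surjective since every
algebraic integer of `ℚ(ζ₄)` is `a + bζ` (`exists_int_add_int_mul_eq_four`).
[cite: IrelandRosen1982, Ch. 1 §4 («`GaussianInt = {a + bi | a, b ∈ ℤ}`»)] -/
theorem bijective_toRingOfIntegersHom (hζ : IsPrimitiveRoot ζ 4) : Function.Bijective (toRingOfIntegersHom hζ) := by
  refine ⟨Zsqrtd.lift_injective _ fun n h => ?_, fun x => ?_⟩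
  · nlinarith [mul_self_nonneg n]
  · obtain ⟨a, b, rfl⟩ := exists_int_add_int_mul_eq_four hζ x
    exact ⟨⟨a, b⟩, by rw [toRingOfIntegersHom_apply]⟩

/-- **`GaussianInt ≅ 𝓞_{ℚ(ζ₄)}`**: the ring isomorphism `a + bi ↦ a + bζ` between Mathlib's `GaussianInt` and the ring of
integers of an abstract `ℚ(i)` with a chosen primitive fourth root of unity `ζ`. [cite: IrelandRosen1982, Ch. 1 §4] -/
def toRingOfIntegers (hζ : IsPrimitiveRoot ζ 4) : GaussianInt ≃+* 𝓞 K :=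
  RingEquiv.ofBijective (toRingOfIntegersHom hζ) (bijective_toRingOfIntegersHom hζ)

/-- `Φ(a + bi) = a + bζ` («`ℤ[i] = {a + bi | a, b ∈ ℤ}`»). [cite: IrelandRosen1982, Ch. 1 §4] -/
theorem toRingOfIntegers_apply (hζ : IsPrimitiveRoot ζ 4) (x : GaussianInt) :
    toRingOfIntegers hζ x = (x.re : 𝓞 K) + (x.im : 𝓞 K) * ζ := rfl

/-- `Φ(i) = ζ` (`i² = -1`). [cite: IrelandRosen1982, Ch. 1 §4] -/
theorem toRingOfIntegers_I (hζ : IsPrimitiveRoot ζ 4) : toRingOfIntegers hζ ⟨0, 1⟩ = ζ := by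
  rw [toRingOfIntegers_apply]; push_cast; ring

/-- **`N(a + bi) = a² + b²` on both sides**: `Norm_{K/ℚ}(Φ x) = N(x)` (`norm_int_add_int_mul_four`).
[cite: IrelandRosen1982, Ch. 1 §4 («`λ(a + bi) = a² + b²`»)] -/
theorem norm_toRingOfIntegers (hζ : IsPrimitiveRoot ζ 4) (x : GaussianInt) :
    Algebra.norm ℤ (toRingOfIntegers hζ x) = x.norm := by
  rw [toRingOfIntegers_apply, norm_int_add_int_mul_four hζ, Zsqrtd.norm_def]; ring

/-- `N((Φ x)) = N(x)`: the absolute norm of the principal ideal `(a + bζ)` is `a² + b²` («`λ(a + bi) = a² + b²`»).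
[cite: IrelandRosen1982, Ch. 1 §4; Ch. 9 §7 p. 120] -/
theorem absNorm_span_toRingOfIntegers (hζ : IsPrimitiveRoot ζ 4) (x : GaussianInt) :
    Ideal.absNorm (Ideal.span {toRingOfIntegers hζ x}) = x.norm.natAbs := by
  rw [Ideal.absNorm_span_singleton, norm_toRingOfIntegers hζ]

/-- **Primarity transported** (Ireland–Rosen Ch. 9 §7, Definition and Lemma 6): `x ∈ GaussianInt` is primary in the
congruence sense of `GaussianPrimary.IsPrimary` iff `Φ x ≡ 1 (mod 2 + 2ζ)`. [cite: IrelandRosen1982, Ch. 9 §7 Lemma 6] -/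
theorem isPrimary_iff_sub_one_mem_span (hζ : IsPrimitiveRoot ζ 4) (x : GaussianInt) :
    IsPrimary x ↔ toRingOfIntegers hζ x - 1 ∈ Ideal.span {(2 + 2 * ζ : 𝓞 K)} := by
  rw [toRingOfIntegers_apply, int_add_int_mul_sub_one_mem_span_iff_four hζ]
  rfl

omit [IsCyclotomicExtension {4} ℚ K] in
/-- Coprimality is transported along a ring isomorphism. [folklore] -/
private theorem isCoprime_map_iff {R S : Type*} [CommRing R] [CommRing S] (e : R ≃+* S) (a b : R) :
    IsCoprime (e a) (e b) ↔ IsCoprime a b := by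
  constructor
  · rintro ⟨u, v, h⟩
    refine ⟨e.symm u, e.symm v, e.injective ?_⟩
    simp [h]
  · rintro ⟨u, v, h⟩
    exact ⟨e u, e v, by rw [← map_mul, ← map_mul, ← map_add, h, map_one]⟩

end Bridge

/-! ### §2 The quartic symbol `(D/x)₄` of a rational integer `D` modulo `x ∈ GaussianInt` -/

section Symbol

/-- The model `ℚ(ζ₄)` on which the symbol is read. [folklore] -/
abbrev K₄ : Type := CyclotomicField 4 ℚ

/-- `ℚ(ζ₄)/ℚ` is cyclotomic for `S = {4}` (Mathlib's `CyclotomicField.isCyclotomicExtension` at the literal `4`, which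
instance search does not find by itself; used through `haveI` in proofs, never registered as an instance).
[cite: IrelandRosen1982, Ch. 13 §2 (the cyclotomic field `ℚ(ζ_m)`, `m = 4`)] -/
theorem isCyclotomicExtension_K₄ : IsCyclotomicExtension {4} ℚ K₄ :=
  CyclotomicField.isCyclotomicExtension 4 ℚ

/-- A primitive fourth root of unity in `𝓞 ℚ(ζ₄)`. [folklore] -/
def ζ₄ : 𝓞 K₄ :=
  haveI := isCyclotomicExtension_K₄
  (IsCyclotomicExtension.zeta_spec 4 ℚ K₄).toInteger

/-- `ζ₄ = i` is a primitive fourth root of unity (the units `1, -1, i, -i` of `ℤ[i]`). [cite: IrelandRosen1982, Ch. 9 §7 p. 120] -/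
theorem isPrimitiveRoot_ζ₄ : IsPrimitiveRoot ζ₄ 4 := by
  haveI := isCyclotomicExtension_K₄
  exact (IsCyclotomicExtension.zeta_spec 4 ℚ K₄).toInteger_isPrimitiveRoot

/-- The bridge at the model: `Φ₄ : GaussianInt ≃+* 𝓞 ℚ(ζ₄)`, `i ↦ ζ₄`. [folklore] -/
def Φ₄ : GaussianInt ≃+* 𝓞 K₄ :=
  haveI := isCyclotomicExtension_K₄
  toRingOfIntegers isPrimitiveRoot_ζ₄

/-- `Φ₄(a + bi) = a + bζ₄` («`ℤ[i] = {a + bi | a, b ∈ ℤ}`»). [cite: IrelandRosen1982, Ch. 1 §4] -/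
theorem Φ₄_apply (x : GaussianInt) : Φ₄ x = (x.re : 𝓞 K₄) + (x.im : 𝓞 K₄) * ζ₄ := rfl

/-- `N((Φ₄ x)) = N(x) = a² + b²` («`λ(a + bi) = a² + b²`»). [cite: IrelandRosen1982, Ch. 1 §4; Ch. 9 §7 p. 120] -/
theorem absNorm_span_Φ₄ (x : GaussianInt) : Ideal.absNorm (Ideal.span {Φ₄ x}) = x.norm.natAbs := by
  haveI := isCyclotomicExtension_K₄
  exact absNorm_span_toRingOfIntegers isPrimitiveRoot_ζ₄ x

/-- `x` primary iff `Φ₄ x ≡ 1 (mod 2 + 2ζ₄)`. [cite: IrelandRosen1982, Ch. 9 §7 Lemma 6] -/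
theorem isPrimary_iff_Φ₄ (x : GaussianInt) : IsPrimary x ↔ Φ₄ x - 1 ∈ Ideal.span {(2 + 2 * ζ₄ : 𝓞 K₄)} := by
  haveI := isCyclotomicExtension_K₄
  exact isPrimary_iff_sub_one_mem_span isPrimitiveRoot_ζ₄ x

/-- **`(D/x)₄ ∈ GaussianInt`** for `D ∈ ℤ`, `x ∈ GaussianInt`: Ireland–Rosen's `χ_x(D) = ∏ᵢ χ_{λᵢ}(D)` over a prime factorisation
`x = ∏ λᵢ` (Ch. 9 §8; for ideals Ch. 14 §2), a function of the ideal `(x)`, pulled back from the tree's `quarticSymbol`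
on `𝓞 ℚ(ζ₄)`.  Values `0, ±1, ±i`; `(D/0)₄ = 1` (junk: empty factorisation). [cite: IrelandRosen1982, Ch. 9 §8, Definition after Prop. 9.8.4; Ch. 14 §2, Definition] -/
def quarticSymbolInt (D : ℤ) (x : GaussianInt) : GaussianInt :=
  Φ₄.symm (quarticSymbol (Ideal.span {Φ₄ x}) (D : 𝓞 K₄))

/-- Unfolding: `Φ₄ ((D/x)₄) = χ_{(Φ₄ x)}(D)`, Ireland–Rosen's `χ_α(β) = ∏ χ_{λᵢ}(β)`. [cite: IrelandRosen1982, Ch. 9 §8, Definition after Prop. 9.8.4] -/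
theorem map_quarticSymbolInt (D : ℤ) (x : GaussianInt) :
    Φ₄ (quarticSymbolInt D x) = quarticSymbol (Ideal.span {Φ₄ x}) (D : 𝓞 K₄) := by
  rw [quarticSymbolInt, RingEquiv.apply_symm_apply]

/-- `(D/u)₄ = 1` for a unit `u`. [cite: IrelandRosen1982, Ch. 9 §8, Definition after Prop. 9.8.4] -/
theorem quarticSymbolInt_of_isUnit (D : ℤ) {u : GaussianInt} (hu : IsUnit u) : quarticSymbolInt D u = 1 := by
  apply Φ₄.injective
  rw [map_quarticSymbolInt, quarticSymbol_span_of_isUnit (hu.map _), map_one]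

/-- `(D/1)₄ = 1`. [cite: IrelandRosen1982, Ch. 9 §8, Definition after Prop. 9.8.4] -/
theorem quarticSymbolInt_one (D : ℤ) : quarticSymbolInt D 1 = 1 :=
  quarticSymbolInt_of_isUnit D isUnit_one

/-- **`(D/xy)₄ = (D/x)₄ (D/y)₄`** for nonzero `x, y` («`χ_{αα'} = χ_α χ_{α'}`», the Definition).
[cite: IrelandRosen1982, Ch. 9 §8, Definition after Prop. 9.8.4; Ch. 14 §2, Prop. 14.2.3 (b)] -/
theorem quarticSymbolInt_mul (D : ℤ) {x y : GaussianInt} (hx : x ≠ 0) (hy : y ≠ 0) :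
    quarticSymbolInt D (x * y) = quarticSymbolInt D x * quarticSymbolInt D y := by
  apply Φ₄.injective
  rw [map_mul, map_quarticSymbolInt, map_quarticSymbolInt, map_quarticSymbolInt, map_mul,
    quarticSymbol_span_mul ((map_ne_zero_iff _ Φ₄.injective).mpr hx) ((map_ne_zero_iff _ Φ₄.injective).mpr hy)]

/-- `(D/x^k)₄ = (D/x)₄^k` for nonzero `x`. [cite: IrelandRosen1982, Ch. 9 §8, Definition after Prop. 9.8.4] -/
theorem quarticSymbolInt_pow (D : ℤ) {x : GaussianInt} (hx : x ≠ 0) (k : ℕ) :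
    quarticSymbolInt D (x ^ k) = quarticSymbolInt D x ^ k := by
  induction k with
  | zero => rw [pow_zero, pow_zero, quarticSymbolInt_one]
  | succ k ih => rw [pow_succ, quarticSymbolInt_mul D (pow_ne_zero _ hx) hx, ih, pow_succ]

/-- `(D/ux)₄ = (D/x)₄` for a unit `u`: the symbol is a function of the ideal `(x)`.
[cite: IrelandRosen1982, Ch. 9 §8, Prop. 9.8.3 (f)] -/
theorem quarticSymbolInt_isUnit_mul (D : ℤ) {u : GaussianInt} (hu : IsUnit u) (x : GaussianInt) :
    quarticSymbolInt D (u * x) = quarticSymbolInt D x := by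
  apply Φ₄.injective
  rw [map_quarticSymbolInt, map_quarticSymbolInt, map_mul, Ideal.span_singleton_mul_left_unit (hu.map _)]

/-- `(D/x̃)₄ = (D/x)₄` for the primary associate `x̃` of an odd `x`. [cite: IrelandRosen1982, Ch. 9 §8, Prop. 9.8.3 (f)] -/
theorem quarticSymbolInt_primary (D : ℤ) {x : GaussianInt} (hx : (x.re + x.im) % 2 = 1) :
    quarticSymbolInt D (primary x) = quarticSymbolInt D x := by
  obtain ⟨u, hu, hux⟩ := exists_isUnit_primary_eq hx
  rw [hux, quarticSymbolInt_isUnit_mul D hu]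

/-- **`(DD'/x)₄ = (D/x)₄ (D'/x)₄`** (Prop. 9.8.3 (b) factor by factor). [cite: IrelandRosen1982, Ch. 9 §8, Prop. 9.8.3 (b); Ch. 14 §2, Prop. 14.2.3 (a)] -/
theorem quarticSymbolInt_mul_left (D D' : ℤ) (x : GaussianInt) :
    quarticSymbolInt (D * D') x = quarticSymbolInt D x * quarticSymbolInt D' x := by
  apply Φ₄.injective
  rw [map_mul, map_quarticSymbolInt, map_quarticSymbolInt, map_quarticSymbolInt, Int.cast_mul,
    quarticSymbol_mul_right isPrimitiveRoot_ζ₄]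

/-- `(1/x)₄ = 1` for primary `x` (no prime above `2` divides `x`; at such primes the tree's symbol is junk).
[cite: IrelandRosen1982, Ch. 9 §8, Prop. 9.8.3 (b)] -/
theorem quarticSymbolInt_one_left {x : GaussianInt} (hx : IsPrimary x) : quarticSymbolInt 1 x = 1 := by
  haveI := isCyclotomicExtension_K₄
  apply Φ₄.injective
  rw [map_quarticSymbolInt, Int.cast_one, map_one]
  exact quarticSymbol_one_right isPrimitiveRoot_ζ₄ fun v hv ↦
    two_not_mem_of_mem_of_sub_one_mem_span ((Ideal.span_singleton_le_iff_mem _).mp hv) ((isPrimary_iff_Φ₄ x).mp hx)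

/-- `(D^k/x)₄ = (D/x)₄^k` for primary `x`. [cite: IrelandRosen1982, Ch. 9 §8, Prop. 9.8.3 (b)] -/
theorem quarticSymbolInt_pow_left (D : ℤ) (k : ℕ) {x : GaussianInt} (hx : IsPrimary x) :
    quarticSymbolInt (D ^ k) x = quarticSymbolInt D x ^ k := by
  induction k with
  | zero => rw [pow_zero, pow_zero, quarticSymbolInt_one_left hx]
  | succ k ih => rw [pow_succ, quarticSymbolInt_mul_left, ih, pow_succ]

/-- The values of `(D/x)₄` at nonzero `x` are `0` or fourth roots of unity. [cite: IrelandRosen1982, Ch. 9 §8, Definition after Prop. 9.8.2] -/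
theorem quarticSymbolInt_eq_zero_or_pow_four (D : ℤ) {x : GaussianInt} (hx : x ≠ 0) :
    quarticSymbolInt D x = 0 ∨ quarticSymbolInt D x ^ 4 = 1 := by
  induction x using UniqueFactorizationMonoid.induction_on_prime with
  | h₁ => exact absurd rfl hx
  | h₂ u hu => exact Or.inr (by rw [quarticSymbolInt_of_isUnit D hu, one_pow])
  | h₃ a π ha hπ ih =>
    rw [quarticSymbolInt_mul D hπ.ne_zero ha]
    have hπK : Prime (Φ₄ π) := (MulEquiv.prime_iff (Φ₄ : GaussianInt ≃* 𝓞 K₄)).mpr hπ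
    let 𝔭 : HeightOneSpectrum (𝓞 K₄) :=
      ⟨Ideal.span {Φ₄ π}, (Ideal.span_singleton_prime hπK.ne_zero).mpr hπK,
        by rw [Ne, Ideal.span_singleton_eq_bot]; exact hπK.ne_zero⟩
    have hπval : quarticSymbolInt D π = 0 ∨ quarticSymbolInt D π ^ 4 = 1 := by
      have h := quarticResidueSymbol_eq_zero_or_pow_four isPrimitiveRoot_ζ₄ 𝔭
        (Ideal.Quotient.mk 𝔭.asIdeal (D : 𝓞 K₄))
      rw [← quarticSymbol_span_of_span_eq (show 𝔭.asIdeal = Ideal.span {Φ₄ π} from rfl),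
        ← map_quarticSymbolInt, ← map_pow, ← map_one Φ₄, ← map_zero Φ₄] at h
      exact h.imp (fun h ↦ Φ₄.injective h) (fun h ↦ Φ₄.injective h)
    rcases hπval with h0 | h1
    · exact Or.inl (by rw [h0, zero_mul])
    · rcases ih ha with h0' | h1'
      · exact Or.inl (by rw [h0', mul_zero])
      · exact Or.inr (by rw [mul_pow, h1, h1', one_mul])

/-- **The twist `x ↦ (D/x)₄` has modulus `8D`** (Ireland–Rosen Ch. 18 §6, proof of Theorem 7): for nonzero
`x ≡ x' (mod 8D)` with `x'` coprime to `8D`, `(D/x)₄ = (D/x')₄`. [cite: IrelandRosen1982, Ch. 18 §6, Theorem 7 (proof)] -/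
theorem quarticSymbolInt_eq_of_dvd_sub {D : ℤ} (hD : D ≠ 0) {x x' : GaussianInt} (hx : x ≠ 0) (hx' : x' ≠ 0)
    (hcop : IsCoprime x' ((8 * D : ℤ) : GaussianInt)) (h : ((8 * D : ℤ) : GaussianInt) ∣ x - x') :
    quarticSymbolInt D x = quarticSymbolInt D x' := by
  haveI := isCyclotomicExtension_K₄
  apply Φ₄.injective
  rw [map_quarticSymbolInt, map_quarticSymbolInt]
  refine quarticSymbol_span_eq_of_sub_mem_span isPrimitiveRoot_ζ₄ hD
    ((map_ne_zero_iff _ Φ₄.injective).mpr hx) ((map_ne_zero_iff _ Φ₄.injective).mpr hx') ?_ ?_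
  · rw [Ideal.isCoprime_span_singleton_iff, show ((8 * D : ℤ) : 𝓞 K₄) = Φ₄ ((8 * D : ℤ) : GaussianInt) from
      (map_intCast Φ₄ _).symm, isCoprime_map_iff]
    exact hcop
  · rw [Ideal.mem_span_singleton, show ((8 * D : ℤ) : 𝓞 K₄) = Φ₄ ((8 * D : ℤ) : GaussianInt) from
      (map_intCast Φ₄ _).symm, ← map_sub, map_dvd_iff]
    exact h

/-- **Ireland–Rosen Prop. 9.9.8 on `GaussianInt`**: for `a ∈ ℤ` with `a ≡ 1 (4)` and a primary `x` coprime to `a`,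
`(a/x)₄ = (x/a)₄`, the right-hand side being the symbol of `x` modulo the ideal `(a)` read through `Φ₄`.
[cite: IrelandRosen1982, Ch. 9 §9, Prop. 9.9.8] -/
theorem map_quarticSymbolInt_of_isPrimary {a : ℤ} (ha : a % 4 = 1) {x : GaussianInt} (hx : IsPrimary x)
    (hcop : IsCoprime x (a : GaussianInt)) :
    Φ₄ (quarticSymbolInt a x) = quarticSymbol (Ideal.span {(a : 𝓞 K₄)}) (Φ₄ x) := by
  haveI := isCyclotomicExtension_K₄
  rw [map_quarticSymbolInt]
  refine (quarticSymbol_span_intCast_primary_comm isPrimitiveRoot_ζ₄ ha ((isPrimary_iff_Φ₄ x).mp hx) ?_).symm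
  rw [show (a : 𝓞 K₄) = Φ₄ (a : GaussianInt) from (map_intCast Φ₄ a).symm, isCoprime_map_iff]
  exact hcop

end Symbol

/-! ### §3 The quartic character modulo the inert prime `3`: `(x/3)₄ ≡ x² (mod 3)` -/

section Three

/-- **The quartic residue character modulo `3`** on `GaussianInt`, `(x/3)₄ ≡ x^{(N(3)-1)/4} = x² (mod 3)`, by its table on
`GaussianInt/3 = 𝔽₉`: `0` on `3 ∣ x`; `1` on `±1`; `-1` on `±i`; `-i` on `±(1 + i)`; `i` on `±(1 - i)`.
[cite: IrelandRosen1982, Ch. 9 §8, Definition after Prop. 9.8.2 (at the prime `3`, `N(3) = 9`)] -/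
def quarticCharThree (x : GaussianInt) : GaussianInt :=
  if (3 : ℤ) ∣ x.re ∧ (3 : ℤ) ∣ x.im then 0
  else if (3 : ℤ) ∣ x.im then 1
  else if (3 : ℤ) ∣ x.re then -1
  else if (3 : ℤ) ∣ x.re - x.im then ⟨0, -1⟩
  else ⟨0, 1⟩

/-- `(x/3)₄ = 0` iff `3 ∣ x`. [cite: IrelandRosen1982, Ch. 9 §8, Prop. 9.8.3 (a)] -/
theorem quarticCharThree_eq_zero_iff (x : GaussianInt) : quarticCharThree x = 0 ↔ (3 : GaussianInt) ∣ x := by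
  rw [show (3 : GaussianInt) = ((3 : ℤ) : GaussianInt) by rfl, Zsqrtd.intCast_dvd]
  unfold quarticCharThree
  split_ifs with h1 h2 h3 h4 <;> simp_all <;> decide

/-- Euler's criterion at `3`: `3 ∣ x² − (x/3)₄` and `(x/3)₄⁴ = 1` for `3 ∤ x`. [cite: IrelandRosen1982, Ch. 9 §8, Prop. 9.8.2 and Definition (at the prime `3`)] -/
theorem three_dvd_sq_sub_quarticCharThree {x : GaussianInt} (hx : ¬ (3 : GaussianInt) ∣ x) :
    (3 : GaussianInt) ∣ x ^ 2 - quarticCharThree x ∧ quarticCharThree x ^ 4 = 1 := by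
  have cast3 : ∀ n : ℤ, (3 : ℤ) ∣ n ↔ (n : ZMod 3) = 0 := fun n ↦ (ZMod.intCast_zmod_eq_zero_iff_dvd n 3).symm
  obtain ⟨a, b⟩ := x
  rw [show (3 : GaussianInt) = ((3 : ℤ) : GaussianInt) by rfl, Zsqrtd.intCast_dvd] at hx ⊢
  simp only at hx
  unfold quarticCharThree
  split_ifs with h1 h2 h3 h4
  · exact absurd h1 hx
  all_goals
    refine ⟨?_, by decide⟩
    simp only [sq, Zsqrtd.re_sub, Zsqrtd.im_sub, Zsqrtd.re_mul, Zsqrtd.im_mul, Zsqrtd.re_one, Zsqrtd.im_one,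
      Zsqrtd.re_neg, Zsqrtd.im_neg, cast3, not_and] at hx h1 ⊢
    simp only [cast3] at *
    push_cast at *
    generalize (a : ZMod 3) = α at *
    generalize (b : ZMod 3) = β at *
    revert α β
    decide

/-- `(·/3)₄` is multiplicative (a character of `(GaussianInt/3)ˣ = 𝔽₉ˣ`, extended by `0`). [cite: IrelandRosen1982, Ch. 9 §8, Prop. 9.8.3 (b)] -/
theorem quarticCharThree_mul (x y : GaussianInt) :
    quarticCharThree (x * y) = quarticCharThree x * quarticCharThree y := by
  have cast3 : ∀ n : ℤ, (3 : ℤ) ∣ n ↔ (n : ZMod 3) = 0 := fun n ↦ (ZMod.intCast_zmod_eq_zero_iff_dvd n 3).symm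
  -- the table as a function on `𝔽₃ × 𝔽₃`
  let t : ZMod 3 → ZMod 3 → GaussianInt := fun a b ↦
    if a = 0 ∧ b = 0 then 0 else if b = 0 then 1 else if a = 0 then -1 else if a - b = 0 then ⟨0, -1⟩ else ⟨0, 1⟩
  have ht : ∀ z : GaussianInt, quarticCharThree z = t (z.re : ZMod 3) (z.im : ZMod 3) := by
    intro z
    unfold quarticCharThree
    simp only [cast3, Int.cast_sub, t]
  rw [ht, ht, ht]
  simp only [Zsqrtd.re_mul, Zsqrtd.im_mul]
  push_cast
  generalize (x.re : ZMod 3) = a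
  generalize (x.im : ZMod 3) = b
  generalize (y.re : ZMod 3) = c
  generalize (y.im : ZMod 3) = d
  revert a b c d
  decide

/-- `(u/3)₄ = u²` on the units: `1` at `±1`, `-1` at `±i`. [cite: IrelandRosen1982, Ch. 9 §8, Prop. 9.8.3 (d)] -/
theorem quarticCharThree_of_isUnit {u : GaussianInt} (hu : IsUnit u) : quarticCharThree u = u ^ 2 := by
  rcases eq_of_isUnit hu with rfl | rfl | rfl | rfl <;> decide

end Three

end Literature.NumberTheory.QuadraticFields.GaussianQuarticSymbol

end
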